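import Summits.ResolutionOfSingularities.ResolutionOfSingularities.Theorems.EquisingularLiftEquisingularLiftNatCentreCodimTwo
import Summits.ResolutionOfSingularities.ResolutionOfSingularities.Theorems.EquisingularLiftEquisingularLiftNatNoseTraceTools
import Literature.AlgebraicGeometry.Resolution.RegularLocalRingsQuotient
import HarnessLib

/-!
# [OURS · L1 W4.5(b) · EL♮(3) · door ν4, N-0 core W5 «V(𝓦₀) regular off the node sections», piece W5a-model]
# REGULARITY OF A FLAT `O`-SCHEME AT A POINT OF ITS SPECIAL FIBRE FROM REGULARITY OF THE SPECIAL FIBRE, in a model square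

res-L1-w45b-stub-2 g17 (core W5 of nose-w1's `cores`, desk g25-6). `--supports stmt-ResolutionOfSingularities-20148 --as helper`, no claim,
counted 0. OURS; NOT a statement of [Hironaka2017]; AI-written, weaker than expert review. EL♮(3) is NOT proved here; char-p resolution is NOT proved
anywhere in this tree. DEF-FREE.

* ★ `isRegularLocalRing_quotient_stalkIdeal_of_model` — model square `(j, t; r, Spec θ)` over a DVR `O` (`F = X ×_O k`), `X` locally Noetherian,
  `𝒞` an ideal sheaf with `V(𝒞) → Spec O` FLAT, `𝒟 = 𝒞·𝒪_F`, `z` a point of `V(𝒟)` at which `V(𝒟)` is REGULAR ⇒ `𝒪_{X,jz} ⧸ 𝒞_{jz}` is regular.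
  Proof: the sibling of ✓ `ringKrullDim_quotient_stalkIdeal_eq_of_model` (…NatCentreCodimTwo, whose two ring isomorphisms are re-used verbatim):
  in `T = 𝒪_{X,jz} ⧸ 𝒞_{jz}` the germ `ϖ̄` is a regular non-unit (flatness) with `T/ϖ̄ ≅ 𝒪_{V(𝒟),z}` regular, so `T` is regular
  (Literature ✓ `IsRegularLocalRing.of_quotient_span_singleton`, Matsumura 19.2 (II)).
* `isRegularLocalRing_subscheme_stalk_of_model` — the same, read on `V(𝒞)`: `𝒪_{V(𝒞),c}` regular at the point `c` over `j z`.

References: [cite: Matsumura1987, Thm. 19.2, Thm. 15.1] [cite: StacksProject, Tag 00KW].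
-/

set_option linter.dupNamespace false

noncomputable section

open CategoryTheory CategoryTheory.Limits AlgebraicGeometry TopologicalSpace Topology IsLocalRing
open Literature.AlgebraicGeometry.Resolution
open AlgebraicGeometry.Scheme.IdealSheafData
open Summit.ResolutionOfSingularities.ResolutionOfSingularities.Cruxes.EquisingularLift.StrataSplit

namespace Summit.ResolutionOfSingularities.ResolutionOfSingularities.Cruxes.EquisingularLiftNat.Sections.Equinodal

open Summit.ResolutionOfSingularities.ResolutionOfSingularities.Cruxes.EquisingularLiftNat.Sections

/-- ★ **Regularity of a flat `O`-scheme at a special-fibre point from regularity of the special fibre, in a model square.** Let `O` be a DVR with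
residue map `θ : O ↠ k`, `(j, t; r, Spec θ)` cartesian (`F = X ×_O k`), `X` locally Noetherian, `𝒞` an ideal sheaf on `X` with `V(𝒞) → Spec O`
FLAT, `𝒟 = 𝒞·𝒪_F`, and `z` a point of `V(𝒟)` with `𝒪_{V(𝒟),z}` regular. Then `𝒪_{X,jz} ⧸ 𝒞_{jz}` is a regular local ring.
[cite: Matsumura1987, Thm. 19.2] [cite: StacksProject, Tag 00KW] [OURS · L1 W4.5b · N-0 core W5, piece W5a-model] -/
theorem isRegularLocalRing_quotient_stalkIdeal_of_model (O : Type) [CommRing O] [IsDomain O] [IsDiscreteValuationRing O]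
    (k : Type) [Field k] (θ : O →+* k) (hθ : Function.Surjective θ) {X F : Scheme.{0}} (r : X ⟶ Spec (.of O))
    (j : F ⟶ X) (t : F ⟶ Spec (.of k)) (hsq : IsPullback j t r (Spec.map (CommRingCat.ofHom θ)))
    [IsLocallyNoetherian X] (𝒞 : X.IdealSheafData) [Flat (𝒞.subschemeι ≫ r)] {𝒟 : F.IdealSheafData}
    (hCD : 𝒞.comap j = 𝒟) (z : ↥𝒟.subscheme) (hreg : IsRegularLocalRing (𝒟.subscheme.presheaf.stalk z)) :
    IsRegularLocalRing (X.presheaf.stalk (j (𝒟.subschemeι z)) ⧸ stalkIdeal 𝒞 (j (𝒟.subschemeι z))) := by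
  -- adapted from `ringKrullDim_quotient_stalkIdeal_eq_of_model` (…NatCentreCodimTwo): same two ring isomorphisms
  subst hCD
  obtain ⟨ϖ, hϖ⟩ := IsDiscreteValuationRing.exists_irreducible O
  haveI : IsClosedImmersion (Spec.map (CommRingCat.ofHom θ)) := IsClosedImmersion.spec_of_surjective _ hθ
  haveI : IsClosedImmersion j := MorphismProperty.IsStableUnderBaseChange.of_isPullback hsq.flip inferInstance
  set z₀ : F := (𝒞.comap j).subschemeι z with hz₀
  set A := X.presheaf.stalk (j z₀) with hA
  set J : Ideal A := stalkIdeal 𝒞 (j z₀) with hJ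
  set ϖb : A := (X.presheaf.Γgerm (j z₀)).hom (r.appTop.hom ((Scheme.ΓSpecIso (.of O)).inv.hom ϖ)) with hϖb
  -- the point lies over the closed point and in the support
  have hrb : r (j z₀) = closedPoint O := by
    have : j z₀ ∈ Set.range j := ⟨z₀, rfl⟩
    rw [range_eq_preimage_of_isPullback hsq, range_specMap_of_surjective_of_field θ hθ] at this
    exact this
  have hb : j z₀ ∈ (𝒞.support : Set X) := by
    have h1 : z₀ ∈ ((𝒞.comap j).support : Set F) := by
      rw [← Scheme.IdealSheafData.range_subschemeι]; exact ⟨z, rfl⟩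
    rw [Scheme.IdealSheafData.support_comap] at h1
    exact h1
  -- `T = A ⧸ J` is a Noetherian local ring in which `ϖ̄` is a regular non-unit
  have hJle : J ≤ maximalIdeal A := (mem_support_iff_stalkIdeal_le 𝒞 (j z₀)).mp hb
  have hJne : J ≠ ⊤ := fun h => (maximalIdeal.isMaximal A).ne_top (top_le_iff.mp (h ▸ hJle))
  haveI : Nontrivial (A ⧸ J) := Ideal.Quotient.nontrivial_iff.mpr hJne
  haveI : IsLocalRing (A ⧸ J) := IsLocalRing.of_surjective' (Ideal.Quotient.mk J) Ideal.Quotient.mk_surjective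
  have hϖm : ϖb ∈ maximalIdeal A := CILift.germ_varpi_mem_maximalIdeal O r ϖ hϖ (j z₀) hrb
  have hϖT : Ideal.Quotient.mk J ϖb ∈ maximalIdeal (A ⧸ J) := by
    rw [maximalIdeal_quotient_eq_map]
    exact Ideal.mem_map_of_mem _ hϖm
  have hregϖ : IsSMulRegular (A ⧸ J) (Ideal.Quotient.mk J ϖb) := by
    rw [isSMulRegular_iff_right_eq_zero_of_smul]
    intro a ha
    obtain ⟨a, rfl⟩ := Ideal.Quotient.mk_surjective a
    rw [smul_eq_mul, ← map_mul, Ideal.Quotient.eq_zero_iff_mem] at ha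
    exact Ideal.Quotient.eq_zero_iff_mem.mpr (mem_stalkIdeal_of_varpi_mul_mem_of_flat r 𝒞 (j z₀) hb hϖ.ne_zero a ha)
  -- `T ⧸ ϖ̄ ≅ A ⧸ (J + ϖ) ≅ 𝒪_{V(𝒟),z}`
  have e1 : (A ⧸ J) ⧸ Ideal.span {Ideal.Quotient.mk J ϖb} ≃+* A ⧸ (J ⊔ Ideal.span {ϖb}) := by
    have hspan : Ideal.span {Ideal.Quotient.mk J ϖb} = (Ideal.span {ϖb}).map (Ideal.Quotient.mk J) := by
      rw [Ideal.map_span, Set.image_singleton]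
    exact (Ideal.quotEquivOfEq hspan).trans (DoubleQuot.quotQuotEquivQuotSup J (Ideal.span {ϖb}))
  have hker_j : RingHom.ker (j.stalkMap z₀).hom = Ideal.span {ϖb} := by
    refine le_antisymm (ker_stalkMap_model_le O k θ hθ r j t hsq z₀ ϖ hϖ) ?_
    rw [Ideal.span_le, Set.singleton_subset_iff, SetLike.mem_coe, RingHom.mem_ker]
    exact stalkMap_model_varpi θ hθ r j t hsq z₀ ϖ (hϖ.maximalIdeal_eq ▸ Ideal.mem_span_singleton_self ϖ)
  set ψ : A →+* (𝒞.comap j).subscheme.presheaf.stalk z :=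
    (((𝒞.comap j).subschemeι).stalkMap z).hom.comp (j.stalkMap z₀).hom with hψ
  have hψsurj : Function.Surjective ψ :=
    (((𝒞.comap j).subschemeι).stalkMap_surjective z).comp (j.stalkMap_surjective z₀)
  have hkerψ : RingHom.ker ψ = J ⊔ Ideal.span {ϖb} := by
    rw [hψ, ← RingHom.comap_ker, ker_stalkMap_subschemeι_eq_stalkIdeal]
    change Ideal.comap (j.stalkMap z₀).hom (stalkIdeal (𝒞.comap j) z₀) = _
    rw [stalkIdeal_comap_eq_map_stalkMap, Ideal.comap_map_of_surjective _ (j.stalkMap_surjective z₀),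
      ← RingHom.ker_eq_comap_bot, hker_j]
  have e2 : A ⧸ (J ⊔ Ideal.span {ϖb}) ≃+* (𝒞.comap j).subscheme.presheaf.stalk z :=
    (Ideal.quotEquivOfEq hkerψ.symm).trans (RingHom.quotientKerEquivOfSurjective hψsurj)
  -- regularity lifts modulo the regular element `ϖ̄`
  haveI : IsRegularLocalRing ((A ⧸ J) ⧸ Ideal.span {Ideal.Quotient.mk J ϖb}) :=
    IsRegularLocalRing.of_ringEquiv (e1.trans e2).symm
  exact IsRegularLocalRing.of_quotient_span_singleton hϖT hregϖ

/-- **The same, read on `V(𝒞)`**: in the setting of `isRegularLocalRing_quotient_stalkIdeal_of_model`, `V(𝒞)` is regular at every point `c`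
over `j z`. [cite: Matsumura1987, Thm. 19.2] [OURS · L1 W4.5b · N-0 core W5, piece W5a-model] -/
theorem isRegularLocalRing_subscheme_stalk_of_model (O : Type) [CommRing O] [IsDomain O] [IsDiscreteValuationRing O]
    (k : Type) [Field k] (θ : O →+* k) (hθ : Function.Surjective θ) {X F : Scheme.{0}} (r : X ⟶ Spec (.of O))
    (j : F ⟶ X) (t : F ⟶ Spec (.of k)) (hsq : IsPullback j t r (Spec.map (CommRingCat.ofHom θ)))
    [IsLocallyNoetherian X] (𝒞 : X.IdealSheafData) [Flat (𝒞.subschemeι ≫ r)] {𝒟 : F.IdealSheafData}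
    (hCD : 𝒞.comap j = 𝒟) (z : ↥𝒟.subscheme) (hreg : IsRegularLocalRing (𝒟.subscheme.presheaf.stalk z))
    (c : ↥𝒞.subscheme) (hc : 𝒞.subschemeι c = j (𝒟.subschemeι z)) :
    IsRegularLocalRing (𝒞.subscheme.presheaf.stalk c) :=
  (isRegularLocalRing_subscheme_stalk_iff_of_eq 𝒞 c _ hc).mpr
    (isRegularLocalRing_quotient_stalkIdeal_of_model O k θ hθ r j t hsq 𝒞 hCD z hreg)

end Summit.ResolutionOfSingularities.ResolutionOfSingularities.Cruxes.EquisingularLiftNat.Sections.Equinodal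

end
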